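import Literature.Analysis.Complex.DiscDirichletProblem
import Literature.Analysis.Complex.HarmonicMaxPrincipleExceptional
import Literature.Analysis.Complex.SchwarzReflection
import HarnessLib

/-!
# The Schwarz reflection principle for harmonic functions vanishing on a segment

Topic `Literature/Analysis/Complex` (harmonic functions; companion of `SchwarzReflection.lean`,
which treats holomorphic functions already continuous up to the axis with real values, and of
`DiscDirichletProblem.lean`). The classical reflection principle in its **harmonic** form
(L. V. Ahlfors, *Complex Analysis*, 3rd ed. (1979), Ch. 4 §6.5, Thm. 26; J. B. Conway,
*Functions of One Complex Variable* (1978), X.3 Exercise / IX.1): let `U ⊆ ℂ` be open and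
symmetric under conjugation, `v` harmonic on `U⁺ = U ∩ {im > 0}`, continuous on `U ∩ {im ≥ 0}`
and `0` on `U ∩ ℝ`; then the odd extension `V(z̄) = -V(z)` is harmonic on `U`. Proof (Ahlfors):
`V` is continuous; about a real point `x` solve the Dirichlet problem on a disc `B(x, r) ⊆ U` with
data `V` (`discPoisson`); the solution is odd under conjugation (symmetry of the Poisson kernel),
hence vanishes on the diameter, and agrees with `V` on each half disc by the maximum principle;
so `V` is harmonic near `x`.

As a consequence, the **holomorphic reflection principle under the weak hypothesis
`im f → 0`** (Ahlfors, Thm. 26, second half): if `f` is holomorphic on `U⁺` and `im f(z) → 0` as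
`z → x` for every real `x ∈ U` (no assumption on `re f`), then `f` extends to a holomorphic
function on `U` satisfying `F(z̄) = conj F(z)` (`exists_differentiableOn_extension_of_tendsto_im`).

* `circleAverage_comp_conj` — circle averages about real centres are invariant under
  conjugation of the variable;
* `poissonKernel_conj`, `discPoisson_conj_of_odd` — the Poisson integral of odd data is odd;
* `oddReflection v`, `continuousOn_oddReflection`, **`harmonicOnNhd_oddReflection`**;
* **`exists_differentiableOn_extension_of_tendsto_im`**.

Everything is proved.

## References

* L. V. Ahlfors, *Complex Analysis*, 3rd ed., McGraw-Hill (1979), Ch. 4 §6.5, Thm. 26 (the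
  reflection principle). [Ahlfors1979]
* J. B. Conway, *Functions of One Complex Variable* (1978), IX.1.1. [Conway1978]
-/

noncomputable section

open Set Filter Metric Topology InnerProductSpace Real
open _root_.Complex
open scoped ComplexConjugate

namespace Literature.Analysis.Complex

/-! ### Conjugation symmetry of circle averages and of the Poisson integral -/

/-- Circle averages about a real centre are invariant under conjugation of the variable:
`avg_{|z-c|=R} f(z̄) = avg_{|z-c|=R} f(z)` (`c, R` real). [folklore] -/
theorem circleAverage_comp_conj {E : Type*} [NormedAddCommGroup E] [NormedSpace ℝ E]
    (f : ℂ → E) (c R : ℝ) :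
    circleAverage (fun z ↦ f (conj z)) c R = circleAverage f c R := by
  rw [circleAverage_eq_circleAverage_zero_one,
    circleAverage_eq_circleAverage_zero_one (f := f)]
  -- reduce to the unit circle, where `conj z = z⁻¹`
  have key : circleAverage (fun z : ℂ ↦ f (conj ((R : ℂ) * z + c))) 0 1 =
      circleAverage (fun z : ℂ ↦ (fun u : ℂ ↦ f ((R : ℂ) * u + c)) z⁻¹) 0 1 := by
    refine circleAverage_congr_sphere fun z hz ↦ ?_
    have hz1 : ‖z‖ = 1 := by simpa using hz
    simp only
    congr 1
    rw [map_add, map_mul, Complex.conj_ofReal, Complex.conj_ofReal,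
      Complex.inv_def, Complex.normSq_eq_norm_sq, hz1]
    simp
  rw [key]
  exact circleAverage_zero_one_congr_inv (f := fun u : ℂ ↦ f ((R : ℂ) * u + c))

/-- Distances to a real point are invariant under conjugation. [folklore] -/
theorem norm_conj_sub_ofReal (z : ℂ) (c : ℝ) : ‖conj z - c‖ = ‖z - c‖ := by
  rw [← Complex.norm_conj (z - c), map_sub, Complex.conj_ofReal]

/-- **Conjugation symmetry of the Poisson kernel** of a disc with real centre:
`P(w̄, z) = P(w, z̄)`. [folklore] -/
theorem poissonKernel_conj (c : ℝ) (w z : ℂ) :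
    poissonKernel c (conj w) z = poissonKernel c w (conj z) := by
  rw [poissonKernel_eq, poissonKernel_eq, norm_conj_sub_ofReal w c, norm_conj_sub_ofReal z c]
  have h3 : ‖z - conj w‖ = ‖conj z - w‖ := by
    rw [← Complex.norm_conj (z - conj w), map_sub, Complex.conj_conj]
  rw [h3]

/-- The circle average of the negative. [folklore] -/
theorem circleAverage_fun_neg {E : Type*} [NormedAddCommGroup E] [NormedSpace ℝ E]
    (f : ℂ → E) (c : ℂ) (R : ℝ) :
    circleAverage (fun z ↦ -f z) c R = -circleAverage f c R := by
  simp only [circleAverage, intervalIntegral.integral_neg, smul_neg]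

/-- **The Poisson integral of odd data is odd**: if `φ(z̄) = -φ(z)` on the circle `|z - c| = R`
(`c` real) then `u(w̄) = -u(w)` for the Poisson integral `u = discPoisson c R φ` on the open
disc. [folklore] -/
theorem discPoisson_conj_of_odd {c R : ℝ} {φ : ℂ → ℝ}
    (hφ : ∀ ζ ∈ sphere (c : ℂ) R, φ (conj ζ) = -φ ζ) {w : ℂ} (hw : w ∈ ball (c : ℂ) R) :
    discPoisson c R φ (conj w) = -discPoisson c R φ w := by
  have hw' : conj w ∈ ball (c : ℂ) R := by
    rwa [mem_ball, dist_eq_norm, norm_conj_sub_ofReal, ← dist_eq_norm, ← mem_ball]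
  have hsph : ∀ ζ ∈ sphere (c : ℂ) R, conj ζ ∈ sphere (c : ℂ) R := fun ζ hζ ↦ by
    rwa [mem_sphere, dist_eq_norm, norm_conj_sub_ofReal, ← dist_eq_norm, ← mem_sphere]
  have hR : 0 < R := lt_of_le_of_lt dist_nonneg (mem_ball.1 hw)
  rw [discPoisson_eq_of_mem_ball hw', discPoisson_eq_of_mem_ball hw]
  calc circleAverage (fun z ↦ poissonKernel c (conj w) z * φ z) c R
      = circleAverage (fun z ↦ -(poissonKernel c w (conj z) * φ (conj z))) c R := by
        refine circleAverage_congr_sphere fun ζ hζ ↦ ?_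
        have hζ' : ζ ∈ sphere (c : ℂ) R := by rwa [abs_of_pos hR] at hζ
        simp only [poissonKernel_conj, hφ ζ hζ']
        ring
    _ = -circleAverage (fun z ↦ poissonKernel c w (conj z) * φ (conj z)) c R :=
        circleAverage_fun_neg _ _ _
    _ = -circleAverage (fun z ↦ poissonKernel c w z * φ z) c R := by
        rw [circleAverage_comp_conj (fun z ↦ poissonKernel c w z * φ z) c R]

/-! ### The odd reflection of a function vanishing on the real axis -/

/-- **The odd reflection** across the real axis: `v` on `{im ≥ 0}`, `-v(z̄)` below. [folklore] -/
def oddReflection (v : ℂ → ℝ) (z : ℂ) : ℝ := if 0 ≤ z.im then v z else -v (conj z)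

/-- Above the axis (inclusive) the odd reflection is `v`. [folklore] -/
theorem oddReflection_of_nonneg {v : ℂ → ℝ} {z : ℂ} (hz : 0 ≤ z.im) : oddReflection v z = v z :=
  if_pos hz

/-- Below the axis the odd reflection is `-v(z̄)`. [folklore] -/
theorem oddReflection_of_neg {v : ℂ → ℝ} {z : ℂ} (hz : z.im < 0) :
    oddReflection v z = -v (conj z) :=
  if_neg (not_le.2 hz)

/-- The odd reflection is odd under conjugation, at points where `v` vanishes on the axis.
[folklore] -/
theorem oddReflection_conj {v : ℂ → ℝ} {z : ℂ} (h0 : z.im = 0 → v z = 0) :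
    oddReflection v (conj z) = -oddReflection v z := by
  rcases lt_trichotomy z.im 0 with hneg | hzero | hpos
  · rw [oddReflection_of_neg hneg, oddReflection_of_nonneg (by simp; linarith)]
    ring
  · have hz : conj z = z := Complex.conj_eq_iff_im.2 hzero
    rw [hz, oddReflection_of_nonneg hzero.ge, h0 hzero]
    ring
  · rw [oddReflection_of_nonneg hpos.le, oddReflection_of_neg (by simp; linarith),
      Complex.conj_conj]

/-- **The odd reflection is continuous** on a conjugation-symmetric open set when `v` is
continuous on the closed upper part and vanishes on the axis. [folklore] -/
theorem continuousOn_oddReflection {U : Set ℂ} (hsymm : ∀ z ∈ U, conj z ∈ U) {v : ℂ → ℝ}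
    (hvc : ContinuousOn v (U ∩ {z | 0 ≤ z.im})) (hv0 : ∀ z ∈ U, z.im = 0 → v z = 0) :
    ContinuousOn (oddReflection v) U := by
  refine ContinuousOn.if (p := fun z : ℂ ↦ 0 ≤ z.im) ?_ ?_ ?_
  · intro a ha
    rw [frontier_setOf_le_im] at ha
    have him : a.im = 0 := ha.2
    have hca : conj a = a := Complex.conj_eq_iff_im.2 him
    rw [hca, hv0 a ha.1 him]
    ring
  · have hcl : closure {z : ℂ | 0 ≤ z.im} = {z | 0 ≤ z.im} :=
      (isClosed_le continuous_const Complex.continuous_im).closure_eq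
    rw [hcl]
    exact hvc
  · have hset : {z : ℂ | ¬0 ≤ z.im} = {z | z.im < 0} := by ext z; simp [not_le]
    rw [hset, closure_setOf_im_lt]
    have hmaps : MapsTo (fun z : ℂ ↦ conj z) (U ∩ {z | z.im ≤ 0}) (U ∩ {z | 0 ≤ z.im}) :=
      fun z hz ↦ ⟨hsymm z hz.1, by simpa using hz.2⟩
    exact (hvc.comp Complex.continuous_conj.continuousOn hmaps).neg

/-- **Uniqueness for the Dirichlet problem on a bounded domain, continuous up to the boundary**:
a function harmonic on a bounded open preconnected `W`, continuous on `closure W` and zero on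
`frontier W` vanishes on `W` (the lim-sup maximum principle applied to `±u`). [folklore] -/
theorem eq_zero_of_harmonic_of_frontier {W : Set ℂ} (hWo : IsOpen W) (hWc : IsPreconnected W)
    (hWb : Bornology.IsBounded W) {u : ℂ → ℝ} (hu : HarmonicOnNhd u W)
    (huc : ContinuousOn u (closure W)) (hbd : ∀ ζ ∈ frontier W, u ζ = 0) :
    ∀ z ∈ W, u z = 0 := by
  have hbot := cocompact_inf_principal_eq_bot_of_isBounded hWb
  have key : ∀ (f : ℂ → ℝ), HarmonicOnNhd f W → ContinuousOn f (closure W) →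
      (∀ ζ ∈ frontier W, f ζ = 0) → ∀ z ∈ W, f z ≤ 0 := by
    intro f hf hfc hf0
    refine harmonic_le_of_frontier_of_cocompact hWo hWc hf (M := 0) ?_ ?_
    · intro ζ hζ ε hε
      have hζcl : ζ ∈ closure W := frontier_subset_closure hζ
      have hcont : ContinuousWithinAt f (closure W) ζ := hfc ζ hζcl
      have h1 : ∀ᶠ z in 𝓝[closure W] ζ, f z < 0 + ε := by
        have := hcont.tendsto
        rw [hf0 ζ hζ] at this
        exact this (Iio_mem_nhds (by linarith))
      exact (h1.filter_mono (nhdsWithin_mono ζ subset_closure)).mono fun z hz ↦ hz.le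
    · intro ε hε
      rw [hbot]; exact eventually_bot
  intro z hz
  have h1 := key u hu huc hbd z hz
  have h2 := key (fun w ↦ -u w) hu.neg huc.neg (fun ζ hζ ↦ by rw [hbd ζ hζ, neg_zero]) z hz
  linarith

/-- **The Schwarz reflection principle for harmonic functions** (Ahlfors, Ch. 4 §6.5, Thm. 26):
let `U` be open and symmetric under conjugation, `v` harmonic on `U ∩ {im > 0}`, continuous on
`U ∩ {im ≥ 0}`, and zero on `U ∩ ℝ`. Then the odd reflection of `v` is harmonic on `U`. Proof:
off the axis this is the harmonicity of `v` and of `-v(z̄)` (the real part of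
`-conj F(z̄)` for a local holomorphic `F` with `re F = v`); at a real point `x`, the Poisson
integral `P` of the reflected data on a disc `B(x, r) ⊆ U` is odd (`discPoisson_conj_of_odd`), so
vanishes on the diameter, and coincides with `v` on the upper half disc and with `-v(z̄)` on the
lower one by uniqueness for the Dirichlet problem on the half discs. [cite: Ahlfors1979, Ch. 4 §6.5 Thm. 26] -/
theorem harmonicOnNhd_oddReflection {U : Set ℂ} (hU : IsOpen U) (hsymm : ∀ z ∈ U, conj z ∈ U)
    {v : ℂ → ℝ} (hv : HarmonicOnNhd v (U ∩ {z | 0 < z.im}))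
    (hvc : ContinuousOn v (U ∩ {z | 0 ≤ z.im})) (hv0 : ∀ z ∈ U, z.im = 0 → v z = 0) :
    HarmonicOnNhd (oddReflection v) U := by
  have hVc : ContinuousOn (oddReflection v) U := continuousOn_oddReflection hsymm hvc hv0
  have hUp : IsOpen (U ∩ {z : ℂ | 0 < z.im}) := hU.inter (isOpen_lt continuous_const continuous_im)
  -- Step 1: above the axis
  have above : ∀ z ∈ U, 0 < z.im → HarmonicAt (oddReflection v) z := by
    intro z hz hpos
    have hev : oddReflection v =ᶠ[𝓝 z] v := by
      filter_upwards [(isOpen_lt continuous_const Complex.continuous_im).mem_nhds hpos] with y hy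
      exact oddReflection_of_nonneg (le_of_lt hy)
    exact (harmonicAt_congr_nhds hev).2 (hv z ⟨hz, hpos⟩)
  -- Step 2: below the axis
  have below : ∀ z ∈ U, z.im < 0 → HarmonicAt (oddReflection v) z := by
    intro z hz hneg
    have hcz : conj z ∈ U ∩ {z : ℂ | 0 < z.im} := ⟨hsymm z hz, by simp; linarith⟩
    obtain ⟨r, hr, hball⟩ := Metric.isOpen_iff.1 hUp _ hcz
    obtain ⟨F, hFa, hFre⟩ := (hv.mono hball).exists_analyticOnNhd_ball_re_eq
    set G : ℂ → ℂ := fun ζ ↦ -((conj ∘ F ∘ conj) ζ) with hG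
    have hGd : DifferentiableOn ℂ G (ball z r) := by
      intro ζ hζ
      have hcζ : conj ζ ∈ ball (conj z) r := by
        rw [mem_ball] at hζ ⊢; rwa [Complex.dist_conj_conj]
      have h1 : DifferentiableAt ℂ (conj ∘ F ∘ conj) ζ :=
        differentiableAt_conj_conj_iff.2 (hFa _ hcζ).differentiableAt
      exact h1.neg.differentiableWithinAt
    have hev : oddReflection v =ᶠ[𝓝 z] fun ζ ↦ (G ζ).re := by
      have hmem : ball z r ∩ {ζ : ℂ | ζ.im < 0} ∈ 𝓝 z :=
        inter_mem (ball_mem_nhds z hr) ((isOpen_lt Complex.continuous_im continuous_const).mem_nhds hneg)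
      filter_upwards [hmem] with ζ hζ
      have hcζ : conj ζ ∈ ball (conj z) r := by
        have := hζ.1; rw [mem_ball] at this ⊢; rwa [Complex.dist_conj_conj]
      rw [oddReflection_of_neg hζ.2, ← hFre hcζ, hG]
      simp
    have hGa : AnalyticAt ℂ G z := hGd.analyticAt (ball_mem_nhds z hr)
    exact (harmonicAt_congr_nhds hev).2 hGa.harmonicAt_re
  -- Step 3: on the axis
  intro z hz
  rcases lt_trichotomy z.im 0 with hneg | hzero | hpos
  · exact below z hz hneg
  swap
  · exact above z hz hpos
  -- a closed disc about the real point `z` inside `U`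
  obtain ⟨r, hr, hsub⟩ : ∃ r > 0, closedBall z r ⊆ U := by
    obtain ⟨r, hr, h⟩ := Metric.isOpen_iff.1 hU z hz
    exact ⟨r / 2, half_pos hr, (closedBall_subset_ball (by linarith)).trans h⟩
  have hzre : ((z.re : ℝ) : ℂ) = z := by
    apply Complex.ext <;> simp [hzero]
  set V := oddReflection v with hVdef
  set P : ℂ → ℝ := discPoisson (z.re : ℂ) r V with hP
  have hPz : P = discPoisson z r V := by rw [hP, hzre]
  have hVsph : ContinuousOn V (sphere z r) := hVc.mono (sphere_subset_closedBall.trans hsub)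
  have hPharm : HarmonicOnNhd P (ball z r) := by
    rw [hPz]; exact harmonicOnNhd_discPoisson hr hVsph
  have hPcont : ContinuousOn P (closedBall z r) := by
    rw [hPz]; exact continuousOn_discPoisson hr hVsph
  have hPsph : ∀ w ∈ sphere z r, P w = V w := fun w hw ↦ by
    rw [hPz]; exact discPoisson_eq_of_mem_sphere hw
  -- oddness of `P`
  have hVodd : ∀ ζ ∈ U, V (conj ζ) = -V ζ := fun ζ hζ ↦ oddReflection_conj (hv0 ζ hζ)
  have hPodd : ∀ w ∈ ball z r, P (conj w) = -P w := by
    intro w hw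
    rw [hP]
    refine discPoisson_conj_of_odd (fun ζ hζ ↦ hVodd ζ (hsub (sphere_subset_closedBall ?_))) ?_
    · rwa [hzre] at hζ
    · rwa [hzre]
  have hPreal : ∀ w ∈ ball z r, w.im = 0 → P w = 0 := fun w hw him ↦ by
    have h := hPodd w hw
    rw [Complex.conj_eq_iff_im.2 him] at h
    linarith
  -- `P = v` on the upper half disc, by uniqueness for the Dirichlet problem there
  set Hp : Set ℂ := ball z r ∩ {w | 0 < w.im} with hHp
  have hHpo : IsOpen Hp := isOpen_ball.inter (isOpen_lt continuous_const Complex.continuous_im)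
  have hHpc : IsPreconnected Hp :=
    ((convex_ball z r).inter (convex_halfSpace_im_gt 0)).isPreconnected
  have hHpb : Bornology.IsBounded Hp := isBounded_ball.subset inter_subset_left
  have hHp_cl : closure Hp ⊆ closedBall z r ∩ {w | 0 ≤ w.im} := by
    refine (closure_inter_subset_inter_closure _ _).trans ?_
    rw [closure_ball z hr.ne', closure_setOf_lt_im]
  have hsubU : closedBall z r ∩ {w : ℂ | 0 ≤ w.im} ⊆ U ∩ {w | 0 ≤ w.im} :=
    inter_subset_inter_left _ hsub
  -- the frontier of the half disc: sphere points or axis points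
  have hfront : ∀ ζ ∈ frontier Hp, ζ ∈ closedBall z r ∧ 0 ≤ ζ.im ∧ (ζ ∈ sphere z r ∨ ζ.im = 0) := by
    intro ζ hζ
    have hcl := hHp_cl (frontier_subset_closure hζ)
    have hnot : ζ ∉ Hp := fun h ↦ by
      have := hζ.2
      rw [hHpo.interior_eq] at this
      exact this h
    refine ⟨hcl.1, hcl.2, ?_⟩
    by_contra hcon
    push Not at hcon
    apply hnot
    refine ⟨?_, lt_of_le_of_ne hcl.2 (Ne.symm hcon.2)⟩
    have h1 : dist ζ z ≤ r := mem_closedBall.1 hcl.1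
    have h2 : dist ζ z ≠ r := fun h ↦ hcon.1 (mem_sphere.2 h)
    exact mem_ball.2 (lt_of_le_of_ne h1 h2)
  have hu_harm : HarmonicOnNhd (fun w ↦ P w - v w) Hp :=
    (hPharm.mono inter_subset_left).sub (hv.mono (inter_subset_inter_left _ (ball_subset_closedBall.trans hsub)))
  have hu_cont : ContinuousOn (fun w ↦ P w - v w) (closure Hp) :=
    (hPcont.mono (hHp_cl.trans inter_subset_left)).sub (hvc.mono (hHp_cl.trans hsubU))
  have hu_bd : ∀ ζ ∈ frontier Hp, P ζ - v ζ = 0 := by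
    intro ζ hζ
    obtain ⟨hζcl, hζim, hcase⟩ := hfront ζ hζ
    rcases hcase with hsph | him
    · rw [hPsph ζ hsph, hVdef, oddReflection_of_nonneg hζim, sub_self]
    · have hζU : ζ ∈ U := hsub hζcl
      rw [hv0 ζ hζU him]
      rcases eq_or_lt_of_le (mem_closedBall.1 hζcl) with heq | hlt
      · rw [hPsph ζ (mem_sphere.2 heq), hVdef, oddReflection_of_nonneg hζim, hv0 ζ hζU him, sub_self]
      · rw [hPreal ζ (mem_ball.2 hlt) him, sub_self]
  have hPv : ∀ w ∈ Hp, P w = v w := fun w hw ↦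
    sub_eq_zero.1 (eq_zero_of_harmonic_of_frontier hHpo hHpc hHpb hu_harm hu_cont hu_bd w hw)
  -- `V = P` on the whole disc
  have hVP : ∀ w ∈ ball z r, V w = P w := by
    intro w hw
    rcases lt_trichotomy w.im 0 with hneg | hzero' | hpos
    · have hcw : conj w ∈ Hp := ⟨by rw [mem_ball] at hw ⊢; rwa [← hzre, ← Complex.dist_conj_conj,
        Complex.conj_conj, Complex.conj_ofReal, hzre], by simp; linarith⟩
      have h1 : P w = -P (conj w) := by
        have := hPodd (conj w) hcw.1
        rw [Complex.conj_conj] at this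
        linarith
      rw [hVdef, oddReflection_of_neg hneg, h1, hPv _ hcw]
    · rw [hPreal w hw hzero', hVdef, oddReflection_of_nonneg hzero'.ge, hv0 w (hsub (ball_subset_closedBall hw)) hzero']
    · rw [hVdef, oddReflection_of_nonneg hpos.le, ← hPv w ⟨hw, hpos⟩]
  have hev : V =ᶠ[𝓝 z] P := by
    filter_upwards [ball_mem_nhds z hr] with w hw using hVP w hw
  exact (harmonicAt_congr_nhds hev).2 (hPharm z (mem_ball_self hr))

/-! ### The holomorphic reflection principle under the hypothesis `im f → 0` -/

/-- The upper half-plane part of `U` accumulates at the real points of `U`. [folklore] -/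
theorem neBot_nhdsWithin_upper {U : Set ℂ} (hU : IsOpen U) {x : ℂ} (hx : x ∈ U) (hxim : x.im = 0) :
    (𝓝[U ∩ {z : ℂ | 0 < z.im}] x).NeBot := by
  rw [← mem_closure_iff_nhdsWithin_neBot, Metric.mem_closure_iff]
  intro ε hε
  obtain ⟨r, hr, hball⟩ := Metric.isOpen_iff.1 hU x hx
  have ht : 0 < min (ε / 2) (r / 2) := lt_min (by linarith) (by linarith)
  refine ⟨x + (min (ε / 2) (r / 2) : ℝ) * I, ⟨hball ?_, ?_⟩, ?_⟩
  · rw [mem_ball, dist_eq_norm, add_sub_cancel_left, norm_mul, Complex.norm_real, norm_I,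
      mul_one, Real.norm_eq_abs, abs_of_pos ht]
    exact (min_le_right _ _).trans_lt (by linarith)
  · show 0 < (x + (min (ε / 2) (r / 2) : ℝ) * I).im
    have : (x + (min (ε / 2) (r / 2) : ℝ) * I).im = min (ε / 2) (r / 2) := by simp [hxim]
    rw [this]; exact ht
  · rw [dist_eq_norm, sub_add_cancel_left, norm_neg, norm_mul, Complex.norm_real, norm_I, mul_one,
      Real.norm_eq_abs, abs_of_pos ht]
    exact (min_le_left _ _).trans_lt (by linarith)

/-- **Local extension at a real point** (the heart of the reflection principle under `im f → 0`):
with `v` the boundary-value-zero extension of `im f` and `V` its odd reflection, harmonic on the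
symmetric open `U`, about a real point `x` with `B(x, r) ⊆ U` there is a holomorphic `G` on
`B(x, r)` with `G = f` on the upper half disc and `G(z̄) = conj G(z)`. Proof: `V = re Φ` for a
holomorphic `Φ` on the disc; `Φ + i f` has zero real part on the upper half disc, hence is a
constant `w` there (open mapping theorem), so `G = i(Φ - w)`; the symmetry of `G` follows from
`Φ(z̄) = -conj Φ(z)` (both sides have real part `V` and agree at `x`) and `re w = 0`.
[cite: Ahlfors1979, Ch. 4 §6.5 Thm. 26] -/
theorem exists_local_reflection {U : Set ℂ} {f : ℂ → ℂ}
    (hf : DifferentiableOn ℂ f (U ∩ {z | 0 < z.im})) {V : ℂ → ℝ} (hV : HarmonicOnNhd V U)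
    (hVf : ∀ z ∈ U, 0 < z.im → V z = (f z).im) (hVodd : ∀ z ∈ U, V (conj z) = -V z)
    {x : ℂ} (hxim : x.im = 0) {r : ℝ} (hr : 0 < r) (hsub : ball x r ⊆ U) :
    ∃ G : ℂ → ℂ, DifferentiableOn ℂ G (ball x r) ∧ EqOn G f (ball x r ∩ {z | 0 < z.im}) ∧
      ∀ z ∈ ball x r, G (conj z) = conj (G z) := by
  have hxc : conj x = x := Complex.conj_eq_iff_im.2 hxim
  have hballsymm : ∀ z ∈ ball x r, conj z ∈ ball x r := fun z hz ↦ by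
    rw [mem_ball] at hz ⊢; rwa [← hxc, Complex.dist_conj_conj]
  obtain ⟨Φ, hΦa, hΦre⟩ := (hV.mono hsub).exists_analyticOnNhd_ball_re_eq
  have hΦre' : ∀ z ∈ ball x r, (Φ z).re = V z := fun z hz ↦ hΦre hz
  -- the upper half disc
  set Bp : Set ℂ := ball x r ∩ {z | 0 < z.im} with hBp
  have hBpo : IsOpen Bp := isOpen_ball.inter (isOpen_lt continuous_const Complex.continuous_im)
  have hBpconn : IsConnected Bp := by
    refine ⟨⟨x + (r / 2 : ℝ) * I, ?_, ?_⟩, ((convex_ball x r).inter (convex_halfSpace_im_gt 0)).isPreconnected⟩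
    · rw [mem_ball, dist_eq_norm, add_sub_cancel_left, norm_mul, Complex.norm_real, norm_I,
        mul_one, Real.norm_eq_abs, abs_of_pos (by positivity)]
      linarith
    · show 0 < (x + (r / 2 : ℝ) * I).im
      have : (x + (r / 2 : ℝ) * I).im = r / 2 := by simp [hxim]
      rw [this]; positivity
  have hBpU : Bp ⊆ U ∩ {z | 0 < z.im} := inter_subset_inter_left _ hsub
  -- `Φ + i f` has zero real part on `Bp`, hence is constant there
  set g : ℂ → ℂ := fun z ↦ Φ z + I * f z with hg
  have hga : AnalyticOnNhd ℂ g Bp := by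
    have hfd : DifferentiableOn ℂ f Bp := hf.mono hBpU
    have hfa : AnalyticOnNhd ℂ f Bp := hfd.analyticOnNhd hBpo
    exact (hΦa.mono inter_subset_left).add (analyticOnNhd_const.mul hfa)
  have hgre : ∀ z ∈ Bp, (g z).re = 0 := fun z hz ↦ by
    simp only [hg, add_re, mul_re, I_re, zero_mul, I_im, one_mul, zero_sub]
    rw [hΦre' z hz.1, hVf z (hsub hz.1) hz.2]
    ring
  obtain ⟨w, hw⟩ := hga.eq_const_of_re_eq_const hgre hBpo hBpconn
  have hwre : w.re = 0 := by
    obtain ⟨z₀, hz₀⟩ := hBpconn.nonempty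
    rw [← hw z₀ hz₀]; exact hgre z₀ hz₀
  -- the symmetry of `Φ`
  set Ψ : ℂ → ℂ := fun z ↦ -conj (Φ (conj z)) with hΨ
  have hΨd : DifferentiableOn ℂ Ψ (ball x r) := by
    intro z hz
    have h1 : DifferentiableAt ℂ (conj ∘ Φ ∘ conj) z :=
      differentiableAt_conj_conj_iff.2 (hΦa _ (hballsymm z hz)).differentiableAt
    exact h1.neg.differentiableWithinAt
  have hΨa : AnalyticOnNhd ℂ Ψ (ball x r) := hΨd.analyticOnNhd isOpen_ball
  have hdiff : AnalyticOnNhd ℂ (fun z ↦ Ψ z - Φ z) (ball x r) := hΨa.sub hΦa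
  have hdre : ∀ z ∈ ball x r, (Ψ z - Φ z).re = 0 := fun z hz ↦ by
    simp only [hΨ, sub_re, neg_re, Complex.conj_re]
    rw [hΦre' _ (hballsymm z hz), hΦre' z hz, hVodd z (hsub hz)]
    ring
  obtain ⟨κ, hκ⟩ := hdiff.eq_const_of_re_eq_const hdre isOpen_ball
    ((convex_ball x r).isConnected ⟨x, mem_ball_self hr⟩)
  have hκ0 : κ = 0 := by
    have h1 := hκ x (mem_ball_self hr)
    have hVx : V x = 0 := by
      have := hVodd x (hsub (mem_ball_self hr))
      rw [hxc] at this; linarith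
    have hΦx : (Φ x).re = 0 := by rw [hΦre' x (mem_ball_self hr), hVx]
    rw [← h1, hΨ]
    simp only [hxc]
    apply Complex.ext
    · simp [hΦx]
    · simp
  have hΦsymm : ∀ z ∈ ball x r, Φ (conj z) = -conj (Φ z) := fun z hz ↦ by
    have h1 := hκ z hz
    rw [hκ0, sub_eq_zero, hΨ] at h1
    -- `-conj (Φ (conj z)) = Φ z`
    have h2 : conj (Φ (conj z)) = -Φ z := by
      have := h1; simp only at this; linear_combination -this
    calc Φ (conj z) = conj (conj (Φ (conj z))) := (Complex.conj_conj _).symm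
      _ = conj (-Φ z) := by rw [h2]
      _ = -conj (Φ z) := map_neg _ _
  -- the extension
  refine ⟨fun z ↦ I * (Φ z - w), ?_, ?_, ?_⟩
  · exact (analyticOnNhd_const.mul (hΦa.sub analyticOnNhd_const)).differentiableOn
  · intro z hz
    have h1 := hw z hz
    simp only [hg] at h1
    show I * (Φ z - w) = f z
    have hI : I * I = -1 := I_mul_I
    linear_combination I * h1 - (f z) * hI
  · intro z hz
    have hwc : conj w = -w := by
      apply Complex.ext <;> simp [hwre]
    show I * (Φ (conj z) - w) = conj (I * (Φ z - w))
    rw [hΦsymm z hz, map_mul, Complex.conj_I, map_sub, hwc]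
    ring

/-- **The reflection principle under the hypothesis `im f → 0`** (Ahlfors, Ch. 4 §6.5,
Thm. 26): let `U ⊆ ℂ` be open and symmetric under conjugation and `f` holomorphic on
`U ∩ {im > 0}` with `im f(z) → 0` as `z → x` inside `U ∩ {im > 0}`, for every real point `x` of
`U`. Then `f` extends to a holomorphic function `F` on `U` with `F(z̄) = conj F(z)`, real on
`U ∩ ℝ`. Proof: `v = im f` (extended by `0` to the axis) is harmonic above the axis, continuous up
to it and `0` there, so its odd reflection `V` is harmonic on `U` (`harmonicOnNhd_oddReflection`);
the local holomorphic extensions of `exists_local_reflection` are then assembled by the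
reflection formula `F = f` above, `conj ∘ f ∘ conj` below, boundary limits on the axis.
[cite: Ahlfors1979, Ch. 4 §6.5 Thm. 26] -/
theorem exists_differentiableOn_extension_of_tendsto_im {U : Set ℂ} (hU : IsOpen U)
    (hsymm : ∀ z ∈ U, conj z ∈ U) {f : ℂ → ℂ} (hf : DifferentiableOn ℂ f (U ∩ {z | 0 < z.im}))
    (hlim : ∀ x ∈ U, x.im = 0 →
      Tendsto (fun z ↦ (f z).im) (𝓝[U ∩ {z | 0 < z.im}] x) (𝓝 0)) :
    ∃ F : ℂ → ℂ, DifferentiableOn ℂ F U ∧ EqOn F f (U ∩ {z | 0 < z.im}) ∧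
      (∀ z ∈ U, F (conj z) = conj (F z)) ∧ ∀ x ∈ U, x.im = 0 → (F x).im = 0 := by
  classical
  set Up : Set ℂ := U ∩ {z | 0 < z.im} with hUp
  have hUpo : IsOpen Up := hU.inter (isOpen_lt continuous_const Complex.continuous_im)
  -- the boundary-value-zero extension of `im f` and its odd reflection
  set v : ℂ → ℝ := fun z ↦ if 0 < z.im then (f z).im else 0 with hv
  have hv_harm : HarmonicOnNhd v Up := by
    intro z hz
    have hev : v =ᶠ[𝓝 z] fun z ↦ (f z).im := by
      filter_upwards [(isOpen_lt continuous_const Complex.continuous_im).mem_nhds hz.2] with y hy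
      exact if_pos hy
    exact (harmonicAt_congr_nhds hev).2 ((hf.analyticAt (hUpo.mem_nhds hz)).harmonicAt_im)
  have hv0 : ∀ z ∈ U, z.im = 0 → v z = 0 := fun z _ hz ↦ by
    rw [hv]; simp [hz]
  have hvc : ContinuousOn v (U ∩ {z | 0 ≤ z.im}) := by
    intro z hz
    rcases eq_or_lt_of_le (show 0 ≤ z.im from hz.2) with hzero | hpos
    · -- an axis point: `v → 0 = v z`
      have hz0 : v z = 0 := hv0 z hz.1 hzero.symm
      have hsplit : U ∩ {z : ℂ | 0 ≤ z.im} = Up ∪ (U ∩ {z | z.im = 0}) := by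
        ext y; constructor
        · rintro ⟨hyU, hy⟩
          rcases eq_or_lt_of_le (show 0 ≤ y.im from hy) with h | h
          · exact Or.inr ⟨hyU, h.symm⟩
          · exact Or.inl ⟨hyU, h⟩
        · rintro (⟨hyU, hy⟩ | ⟨hyU, hy⟩)
          · exact ⟨hyU, le_of_lt (show 0 < y.im from hy)⟩
          · exact ⟨hyU, le_of_eq (show y.im = 0 from hy).symm⟩
      rw [ContinuousWithinAt, hz0, hsplit, nhdsWithin_union, tendsto_sup]
      constructor
      · have h1 := hlim z hz.1 hzero.symm
        refine h1.congr' ?_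
        filter_upwards [self_mem_nhdsWithin] with y hy
        rw [hv]; exact (if_pos hy.2).symm
      · refine tendsto_const_nhds.congr' ?_
        filter_upwards [self_mem_nhdsWithin] with y hy
        have hy0 : y.im = 0 := hy.2
        rw [hv]
        simp [hy0]
    · have hev : v =ᶠ[𝓝 z] fun z ↦ (f z).im := by
        filter_upwards [(isOpen_lt continuous_const Complex.continuous_im).mem_nhds hpos] with y hy
        exact if_pos hy
      have hcont : ContinuousAt (fun z ↦ (f z).im) z :=
        Complex.continuous_im.continuousAt.comp (hf.continuousOn.continuousAt (hUpo.mem_nhds ⟨hz.1, hpos⟩))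
      exact ((continuousAt_congr hev).2 hcont).continuousWithinAt
  set V := oddReflection v with hVdef
  have hVharm : HarmonicOnNhd V U := harmonicOnNhd_oddReflection hU hsymm hv_harm hvc hv0
  have hVf : ∀ z ∈ U, 0 < z.im → V z = (f z).im := fun z _ hz ↦ by
    rw [hVdef, oddReflection_of_nonneg hz.le, hv]; exact if_pos hz
  have hVodd : ∀ z ∈ U, V (conj z) = -V z := fun z hz ↦ oddReflection_conj (hv0 z hz)
  -- the global candidate
  set F : ℂ → ℂ := fun z ↦ if 0 < z.im then f z else if z.im < 0 then conj (f (conj z))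
    else limUnder (𝓝[Up] z) f with hF
  have hF_up : ∀ z, 0 < z.im → F z = f z := fun z hz ↦ by rw [hF]; exact if_pos hz
  have hF_low : ∀ z, z.im < 0 → F z = conj (f (conj z)) := fun z hz ↦ by
    show (if 0 < z.im then f z else if z.im < 0 then conj (f (conj z)) else limUnder (𝓝[Up] z) f) = _
    rw [if_neg (not_lt.2 hz.le), if_pos hz]
  have hF_ax : ∀ z, z.im = 0 → F z = limUnder (𝓝[Up] z) f := fun z hz ↦ by
    show (if 0 < z.im then f z else if z.im < 0 then conj (f (conj z)) else limUnder (𝓝[Up] z) f) = _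
    rw [if_neg (by rw [hz]; exact lt_irrefl 0), if_neg (by rw [hz]; exact lt_irrefl 0)]
  -- near a real point, `F` is the local extension
  have hlocal : ∀ x ∈ U, x.im = 0 → ∃ r > 0, ∃ G : ℂ → ℂ, DifferentiableOn ℂ G (ball x r) ∧
      (∀ z ∈ ball x r, F z = G z) ∧ (G x).im = 0 := by
    intro x hx hxim
    obtain ⟨r, hr, hsub⟩ := Metric.isOpen_iff.1 hU x hx
    obtain ⟨G, hGd, hGf, hGsymm⟩ := exists_local_reflection hf hVharm hVf hVodd hxim hr hsub
    have hxc : conj x = x := Complex.conj_eq_iff_im.2 hxim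
    have hballsymm : ∀ z ∈ ball x r, conj z ∈ ball x r := fun z hz ↦ by
      rw [mem_ball] at hz ⊢; rwa [← hxc, Complex.dist_conj_conj]
    have hGreal : ∀ z ∈ ball x r, z.im = 0 → (G z).im = 0 := fun z hz hzim ↦ by
      have h := hGsymm z hz
      rw [Complex.conj_eq_iff_im.2 hzim] at h
      exact Complex.conj_eq_iff_im.1 h.symm
    refine ⟨r, hr, G, hGd, fun z hz ↦ ?_, hGreal x (mem_ball_self hr) hxim⟩
    rcases lt_trichotomy z.im 0 with hneg | hzero | hpos
    · rw [hF_low z hneg]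
      have hcz : conj z ∈ ball x r ∩ {z | 0 < z.im} := ⟨hballsymm z hz, by simp; linarith⟩
      rw [← hGf hcz, hGsymm z hz, Complex.conj_conj]
    · rw [hF_ax z hzero]
      haveI := neBot_nhdsWithin_upper hU (hsub hz) hzero
      refine Filter.Tendsto.limUnder_eq ?_
      have hGc : ContinuousAt G z := (hGd.differentiableAt (isOpen_ball.mem_nhds hz)).continuousAt
      refine (hGc.tendsto.mono_left nhdsWithin_le_nhds).congr' ?_
      have hmem : ball x r ∩ {z : ℂ | 0 < z.im} ∈ 𝓝[Up] z := by
        refine Filter.inter_mem (mem_nhdsWithin_of_mem_nhds (isOpen_ball.mem_nhds hz)) ?_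
        exact mem_nhdsWithin.2 ⟨univ, isOpen_univ, mem_univ _, fun y hy ↦ hy.2.2⟩
      filter_upwards [hmem] with y hy
      exact hGf hy
    · rw [hF_up z hpos, hGf ⟨hz, hpos⟩]
  refine ⟨F, ?_, fun z hz ↦ hF_up z hz.2, ?_, ?_⟩
  · -- differentiability
    intro z hz
    rcases lt_trichotomy z.im 0 with hneg | hzero | hpos
    · have hev : F =ᶠ[𝓝 z] conj ∘ f ∘ conj := by
        filter_upwards [(isOpen_lt Complex.continuous_im continuous_const).mem_nhds hneg] with y hy
        exact hF_low y hy
      refine (DifferentiableAt.congr_of_eventuallyEq ?_ hev).differentiableWithinAt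
      have hcz : conj z ∈ Up := ⟨hsymm z hz, by simp; linarith⟩
      exact differentiableAt_conj_conj_iff.2 (hf.differentiableAt (hUpo.mem_nhds hcz))
    · obtain ⟨r, hr, G, hGd, hFG, -⟩ := hlocal z hz hzero
      have hev : F =ᶠ[𝓝 z] G := by
        filter_upwards [ball_mem_nhds z hr] with y hy using hFG y hy
      exact ((hGd.differentiableAt (ball_mem_nhds z hr)).congr_of_eventuallyEq hev).differentiableWithinAt
    · have hev : F =ᶠ[𝓝 z] f := by
        filter_upwards [(isOpen_lt continuous_const Complex.continuous_im).mem_nhds hpos] with y hy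
        exact hF_up y hy
      exact ((hf.differentiableAt (hUpo.mem_nhds ⟨hz, hpos⟩)).congr_of_eventuallyEq hev).differentiableWithinAt
  · -- symmetry
    intro z hz
    rcases lt_trichotomy z.im 0 with hneg | hzero | hpos
    · rw [hF_low z hneg, hF_up (conj z) (by simp; linarith), Complex.conj_conj]
    · obtain ⟨r, hr, G, -, hFG, hGx⟩ := hlocal z hz hzero
      have hreal : (F z).im = 0 := by rw [hFG z (mem_ball_self hr)]; exact hGx
      rw [Complex.conj_eq_iff_im.2 hzero, Complex.conj_eq_iff_im.2 hreal]
    · rw [hF_up z hpos, hF_low (conj z) (by simp; linarith), Complex.conj_conj]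
  · intro x hx hxim
    obtain ⟨r, hr, G, -, hFG, hGx⟩ := hlocal x hx hxim
    rw [hFG x (mem_ball_self hr)]; exact hGx

end Literature.Analysis.Complex
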